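import Summits.MatrixMultiplication.MatrixMultiplication.Theorems.AbelianSTPPCensusTALin1700Data3

/-!
# T_A/1700 certificate: kernel evaluation, volumes `756 … 839`

Cell mm-stpp (rung F-M1), T_A/1700 = «no abelian STPP host of order `≤ 1700` beats `τ = 2.371`»; checker in `AbelianSTPPCensusTALin1700Defs.lean`,
checkpoint states in `…TALin1700Data1/2/3.lean`.  `decide` with kernel reduction (standard axioms; no `native_decide`); at most `150` sorted
candidate shapes per segment (× 500 orders) and `Elab.async false` — the safe size at the gate (cf. the T_A/1200 chain).  Each segment
recomputes the next checkpoint from the previous one and checks every sorted candidate shape of its volumes at every order `1201 … 1700`; consumed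
by `TALin1700.seg_sound` / `TALin1700.loopL_sound` in `AbelianSTPPCensusLeafTA1700Closed.lean`.
WHAT THIS IS NOT: arithmetic on shape lists only; no statement about STPP families or `ω`.
-/

set_option linter.dupNamespace false
set_option autoImplicit false
set_option Elab.async false

namespace Summit.MatrixMultiplication.MatrixMultiplication.Theorems.TALin1700

set_option maxHeartbeats 0 in
/-- Segment `756 … 776` (149 sorted shapes): from `st755` the loop reaches `st776`, all checks at orders `1201 … 1700` passing. [original] -/
theorem sg756 : loopL 1201 500 21 756 st755 = (true, st776) := by decide +kernel

set_option maxHeartbeats 0 in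
/-- Segment `777 … 798` (149 sorted shapes): from `st776` the loop reaches `st798`, all checks at orders `1201 … 1700` passing. [original] -/
theorem sg777 : loopL 1201 500 22 777 st776 = (true, st798) := by decide +kernel

set_option maxHeartbeats 0 in
/-- Segment `799 … 819` (145 sorted shapes): from `st798` the loop reaches `st819`, all checks at orders `1201 … 1700` passing. [original] -/
theorem sg799 : loopL 1201 500 21 799 st798 = (true, st819) := by decide +kernel

set_option maxHeartbeats 0 in
/-- Segment `820 … 839` (113 sorted shapes): from `st819` the loop reaches `st839`, all checks at orders `1201 … 1700` passing. [original] -/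
theorem sg820 : loopL 1201 500 20 820 st819 = (true, st839) := by decide +kernel

end Summit.MatrixMultiplication.MatrixMultiplication.Theorems.TALin1700
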